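import Mathlib.Analysis.SpecialFunctions.SmoothTransition
import Literature.Geometry.Riemannian.LipschitzSmoothing
import Literature.Geometry.Riemannian.PerelmanEntropyCutoff
import HarnessLib

/-!
# Smooth cutoffs adapted to geodesic balls, and no local collapsing from (T2) ∧ (T3)
# (Topping 2006, §8.3, the test function of Lemma 8.3.5)

The test function in Topping's proof of Lemma 8.3.5 (2006, §8.3) — and in Perelman 2002, §4,
proof of Thm. 4.1 ("`e^{-f_k} = φ(dist_{t_k}(x, p_k)/r_k)`") — is `φ = ψ(d(x,p)/r)` for a cutoff
`ψ` with `|ψ'| ≤ 3`, a Lipschitz but not smooth function of `x`, used "by approximation".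
`PerelmanEntropyCutoff.lean` proved Lemma 8.3.5 from a SMOOTH cutoff `χ : M → [0,1]`, `χ = 1`
on `B(p, r/2)`, `tsupport χ ⊆ B(p, r)`, `|∇χ|² ≤ K`, and reduced Perelman's no local collapsing
theorem I (`perelman_noLocalCollapsing`) to the existence of such cutoffs with `K = C₀/r²`
(hypothesis (HC) of `perelman_noLocalCollapsing_of_cutoffs`) plus the two analytic estimates
(T2), (T3). Here we PROVE (HC):

* `exists_smooth_clamp` — a `C^∞` clamp `Λ : ℝ → [0,1]`, `Λ = 0` on `(-∞, 1/4]`, `Λ = 1` on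
  `[3/4, ∞)`, `|Λ'| ≤ C` (Mathlib's `Real.smoothTransition`);
* `exists_raw_cutoff` — the raw cutoff `F = θ(min(d(p,·), s)/s)`, `θ(u) = min 1 (max 0 (3 - 4u))`:
  continuous, `[0,1]`-valued, `= 1` on `B(p, s/2)`, positive only in `B(p, 3s/4)`, and
  `4/s`-Lipschitz for the Riemannian distance `d = g.edist` (`RiemannianDistance.lean`), in the
  `ℝ≥0∞` form `ENNReal.ofReal |F x - F y| ≤ (4/s) d(x, y)`;
* `exists_metric_cutoff` — **(HC)**: a universal `C₀` (namely `25 sup|Λ'|²`) such that every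
  smooth Riemannian metric on a closed manifold admits, for all `p` and `s > 0`, a smooth
  `χ : M → [0,1]` with `χ = 1` on `B(p, s/2)`, `tsupport χ ⊆ B(p, s)`, `|∇χ|²_g ≤ C₀/s²`:
  `χ = Λ ∘ χ̃` with `χ̃` the smooth approximation of `F` to within `1/8` and gradient
  `≤ 4/s + 1/s` given by `exists_contMDiff_abs_sub_lt_gradSq_le` (`LipschitzSmoothing.lean`,
  Azagra–Ferrera–López-Mesas–Rangel 2007, Thm. 1);
* `perelman_noLocalCollapsing_of_muMonotone_of_muLowerBound` — **(T2) ∧ (T3) ⇒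
  `perelman_noLocalCollapsing`**, where (T2) is the monotonicity `μ(g(0), τ + T') ≤ μ(g(T'), τ)`
  along a Ricci flow on a closed manifold (Topping (8.3.10): entropy formula Prop. 8.2.1 +
  backward conjugate heat flow Rem. 8.2.5; Perelman (3.4)) and (T3) the lower bound
  `inf_{τ ∈ (0,τ₀]} μ(g, τ) > -∞` (Topping Lemma 8.1.8; Perelman §3.1).

Everything is proved; there are no definitions and no named facts. The named fact
`perelman_noLocalCollapsing` is NOT discharged: what remains is exactly the `𝒲`-entropy
analysis (T2), (T3).

## References

* P. Topping, *Lectures on the Ricci flow*, LMS Lecture Note Series 325, CUP 2006, §8.3, proof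
  of Lemma 8.3.5 (the cutoff `ψ(d(x,p)/r)`, `|ψ'| ≤ 3`, "by approximation, (8.3.5)"), Thm. 8.3.1,
  Thm. 8.3.4, (8.3.10); §8.1, Lemma 8.1.8. [Topping2006]
* G. Perelman, *The entropy formula for the Ricci flow and its geometric applications*,
  arXiv:math/0211159 (2002), §3.1, (3.4); §4, Thm. 4.1 and its proof. [Perelman2002]
* D. Azagra, J. Ferrera, F. López-Mesas, Y. Rangel, *Smooth approximation of Lipschitz functions
  on Riemannian manifolds*, J. Math. Anal. Appl. 326 (2007), Thm. 1. [AzagraEtAl2007]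
-/

noncomputable section

open Bundle Set Function Filter Manifold MeasureTheory
open scoped Manifold ContDiff Topology ENNReal NNReal

namespace Literature.Geometry.Riemannian

open Lorentzian

universe u v w

/-! ### A smooth clamping function with bounded derivative -/

/-- **A smooth clamp.** There are a `C^∞` function `Λ : ℝ → [0, 1]` with `Λ = 0` on `(-∞, 1/4]`,
`Λ = 1` on `[3/4, ∞)`, and a bound `C` for `|Λ'|` (`Λ(t) = smoothTransition (2t - 1/2)`,
Mathlib's `Real.smoothTransition`; `Λ'` is continuous and vanishes off `[0, 1]`). [folklore] -/
theorem exists_smooth_clamp : ∃ (Λ : ℝ → ℝ) (C : ℝ), 0 ≤ C ∧ ContDiff ℝ ∞ Λ ∧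
    (∀ t, 0 ≤ Λ t) ∧ (∀ t, Λ t ≤ 1) ∧ (∀ t, t ≤ 1 / 4 → Λ t = 0) ∧ (∀ t, 3 / 4 ≤ t → Λ t = 1) ∧
    ∀ t, |deriv Λ t| ≤ C := by
  set Λ : ℝ → ℝ := fun t ↦ Real.smoothTransition (2 * t - 1 / 2) with hΛ
  have hΛs : ContDiff ℝ ∞ Λ :=
    Real.smoothTransition.contDiff.comp ((contDiff_const.mul contDiff_id).sub contDiff_const)
  have h0 : ∀ t, t ≤ 1 / 4 → Λ t = 0 := fun t ht ↦
    Real.smoothTransition.zero_of_nonpos (by linarith)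
  have h1 : ∀ t, 3 / 4 ≤ t → Λ t = 1 := fun t ht ↦
    Real.smoothTransition.one_of_one_le (by linarith)
  -- the derivative is continuous and vanishes off `[1/4, 3/4]`
  have hdc : Continuous (deriv Λ) := hΛs.continuous_deriv (by simp)
  obtain ⟨C, hC⟩ := isCompact_Icc.exists_bound_of_continuousOn (s := Icc (0 : ℝ) 1) hdc.continuousOn
  have hd0 : ∀ t, t ∉ Icc (0 : ℝ) 1 → deriv Λ t = 0 := by
    intro t ht
    rw [mem_Icc, not_and_or, not_le, not_le] at ht
    rcases ht with ht | ht
    · have hev : Λ =ᶠ[𝓝 t] fun _ ↦ (0 : ℝ) := by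
        filter_upwards [Iio_mem_nhds (show t < 1 / 4 by linarith)] with u hu
        exact h0 u (le_of_lt hu)
      rw [hev.deriv_eq, deriv_const]
    · have hev : Λ =ᶠ[𝓝 t] fun _ ↦ (1 : ℝ) := by
        filter_upwards [Ioi_mem_nhds (show 3 / 4 < t by linarith)] with u hu
        exact h1 u (le_of_lt hu)
      rw [hev.deriv_eq, deriv_const]
  refine ⟨Λ, max C 0, le_max_right _ _, hΛs, fun t ↦ Real.smoothTransition.nonneg _,
    fun t ↦ Real.smoothTransition.le_one _, h0, h1, fun t ↦ ?_⟩
  by_cases ht : t ∈ Icc (0 : ℝ) 1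
  · exact ((Real.norm_eq_abs _).symm.le.trans (hC t ht)).trans (le_max_left _ _)
  · rw [hd0 t ht, abs_zero]; exact le_max_right _ _

/-! ### A Lipschitz raw cutoff from the Riemannian distance -/

section RawCutoff

variable {E : Type*} [NormedAddCommGroup E] [NormedSpace ℝ E] [FiniteDimensional ℝ E]
  {H : Type*} [TopologicalSpace H] {I : ModelWithCorners ℝ E H}
  {M : Type*} [TopologicalSpace M] [ChartedSpace H M] [IsManifold I ∞ M]
  {g : PseudoRiemannianMetric I ∞ E (TangentSpace I : M → Type _)}

/-- The piecewise linear profile `θ(u) = min 1 (max 0 (3 - 4u))`: `θ = 1` on `u ≤ 1/2`, `θ = 0`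
on `u ≥ 3/4`, values in `[0, 1]`, `4`-Lipschitz. [folklore] -/
theorem abs_profile_sub_profile_le (a b : ℝ) :
    |min 1 (max 0 (3 - 4 * a)) - min 1 (max 0 (3 - 4 * b))| ≤ 4 * |a - b| := by
  calc |min 1 (max 0 (3 - 4 * a)) - min 1 (max 0 (3 - 4 * b))|
      ≤ max |(1 : ℝ) - 1| |max 0 (3 - 4 * a) - max 0 (3 - 4 * b)| := abs_min_sub_min_le_max _ _ _ _
    _ = |max 0 (3 - 4 * a) - max 0 (3 - 4 * b)| := by simp
    _ ≤ max |(0 : ℝ) - 0| |(3 - 4 * a) - (3 - 4 * b)| := abs_max_sub_max_le_max _ _ _ _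
    _ = 4 * |a - b| := by
        rw [sub_self, abs_zero, show (3 - 4 * a) - (3 - 4 * b) = 4 * (b - a) by ring, abs_mul,
          abs_sub_comm b a]
        simp [abs_nonneg]

/-- **The raw cutoff `F = θ(min(d(p,·), s)/s)`** attached to a Riemannian metric `g`, a point `p`
and a scale `s > 0` (Topping 2006, proof of Lemma 8.3.5: `ψ(d(x,p)/r)`): continuous, with values
in `[0, 1]`, equal to `1` on `B(p, s/2)`, positive only inside `B(p, 3s/4)`, and `4/s`-Lipschitz
for the Riemannian distance (in `ℝ≥0∞`). [cite: Topping2006, §8.3, proof of Lemma 8.3.5] -/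
theorem exists_raw_cutoff [T3Space M] (hg : g.IsRiemannian) (p : M) {s : ℝ} (hs : 0 < s) :
    ∃ F : M → ℝ, Continuous F ∧ (∀ x, 0 ≤ F x) ∧ (∀ x, F x ≤ 1) ∧
      (∀ x, g.edist hg p x < ENNReal.ofReal (s / 2) → F x = 1) ∧
      (∀ x, 0 < F x → g.edist hg p x < ENNReal.ofReal (3 * s / 4)) ∧
      ∀ x y, ENNReal.ofReal |F x - F y| ≤ ENNReal.ofReal (4 / s) * g.edist hg x y := by
  set S : ℝ≥0∞ := ENNReal.ofReal s with hS
  set ρ : M → ℝ := fun x ↦ (min (g.edist hg p x) S).toReal with hρ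
  have hρfin : ∀ x, min (g.edist hg p x) S ≠ ⊤ := fun x ↦
    ne_top_of_le_ne_top ENNReal.ofReal_ne_top (min_le_right _ _)
  have hρnn : ∀ x, 0 ≤ ρ x := fun x ↦ ENNReal.toReal_nonneg
  have hρle : ∀ x, ρ x ≤ s := fun x ↦ by
    have := ENNReal.toReal_mono ENNReal.ofReal_ne_top (min_le_right (g.edist hg p x) S)
    rwa [ENNReal.toReal_ofReal hs.le] at this
  -- `ρ` is `1`-Lipschitz for `d_g`
  have hρlip : ∀ x y, g.edist hg x y ≠ ⊤ → |ρ x - ρ y| ≤ (g.edist hg x y).toReal := by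
    have key : ∀ x y, g.edist hg x y ≠ ⊤ → ρ x ≤ ρ y + (g.edist hg x y).toReal := by
      intro x y hxy
      have htri : g.edist hg p x ≤ g.edist hg p y + g.edist hg y x := g.edist_triangle hg p y x
      have hmin : min (g.edist hg p x) S ≤ min (g.edist hg p y) S + g.edist hg y x := by
        rcases le_total (g.edist hg p y) S with h | h
        · rw [min_eq_left h]
          exact (min_le_left _ _).trans htri
        · rw [min_eq_right h]
          exact (min_le_right _ _).trans le_self_add
      have := ENNReal.toReal_mono (ENNReal.add_ne_top.2 ⟨hρfin y, by rwa [g.edist_comm hg]⟩) hmin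
      rw [ENNReal.toReal_add (hρfin y) (by rwa [g.edist_comm hg]), g.edist_comm hg y x] at this
      exact this
    intro x y hxy
    rw [abs_sub_le_iff]
    constructor
    · linarith [key x y hxy]
    · have := key y x (by rwa [g.edist_comm hg])
      rw [g.edist_comm hg] at this
      linarith
  -- continuity of `ρ`
  have hρc : Continuous ρ := by
    have h1 : Continuous fun x ↦ min (g.edist hg p x) S :=
      ((PseudoRiemannianMetric.continuous_edist hg).comp (Continuous.prodMk_right p)).min
        continuous_const
    exact ENNReal.continuousOn_toReal.comp_continuous h1 (fun x ↦ hρfin x)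
  refine ⟨fun x ↦ min 1 (max 0 (3 - 4 * (ρ x / s))), ?_, fun x ↦ ?_, fun x ↦ min_le_left _ _,
    fun x hx ↦ ?_, fun x hx ↦ ?_, fun x y ↦ ?_⟩
  · exact continuous_const.min (continuous_const.max (continuous_const.sub
      (continuous_const.mul (hρc.div_const s))))
  · exact le_min zero_le_one (le_max_left _ _)
  · -- `d(p,x) < s/2` ⇒ `ρ x < s/2` ⇒ `3 - 4ρ/s > 1`
    have hlt : min (g.edist hg p x) S = g.edist hg p x :=
      min_eq_left (hx.le.trans (ENNReal.ofReal_le_ofReal (by linarith)))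
    have hρx : ρ x < s / 2 := by
      simp only [hρ, hlt]
      exact (ENNReal.toReal_lt_toReal (hlt ▸ hρfin x) ENNReal.ofReal_ne_top).2 hx |>.trans_eq
        (ENNReal.toReal_ofReal (by linarith))
    have hdiv : ρ x / s < 1 / 2 := by rw [div_lt_iff₀ hs]; linarith
    have h34 : 1 ≤ 3 - 4 * (ρ x / s) := by linarith
    beta_reduce
    rw [min_eq_left]
    exact h34.trans (le_max_right _ _)
  · -- `F x > 0` ⇒ `ρ x < 3s/4` ⇒ `d(p,x) < 3s/4`
    beta_reduce at hx
    have h1 : 0 < 3 - 4 * (ρ x / s) := by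
      by_contra hle
      push Not at hle
      have : max 0 (3 - 4 * (ρ x / s)) = 0 := max_eq_left hle
      rw [this] at hx
      simp at hx
    have hρx : ρ x < 3 * s / 4 := by
      rw [mul_div_assoc', sub_pos, div_lt_iff₀ hs] at h1; linarith
    have hmin : min (g.edist hg p x) S < ENNReal.ofReal (3 * s / 4) := by
      rw [← ENNReal.ofReal_toReal (hρfin x)]
      exact (ENNReal.ofReal_lt_ofReal_iff (by positivity)).2 hρx
    have hlt : g.edist hg p x < S := by
      by_contra hle
      push Not at hle
      rw [min_eq_right hle] at hmin
      exact absurd hmin (not_lt.2 (ENNReal.ofReal_le_ofReal (by linarith)))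
    rwa [min_eq_left hlt.le] at hmin
  · -- Lipschitz
    by_cases hxy : g.edist hg x y = ⊤
    · rw [hxy, ENNReal.mul_top (by simp [hs])]
      exact le_top
    · have hθ := abs_profile_sub_profile_le (ρ x / s) (ρ y / s)
      rw [← sub_div, abs_div, abs_of_pos hs] at hθ
      have hb : |min 1 (max 0 (3 - 4 * (ρ x / s))) - min 1 (max 0 (3 - 4 * (ρ y / s)))| ≤
          4 / s * (g.edist hg x y).toReal := by
        calc _ ≤ 4 * (|ρ x - ρ y| / s) := hθ
          _ ≤ 4 * ((g.edist hg x y).toReal / s) := by gcongr; exact hρlip x y hxy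
          _ = 4 / s * (g.edist hg x y).toReal := by ring
      calc ENNReal.ofReal |min 1 (max 0 (3 - 4 * (ρ x / s))) - min 1 (max 0 (3 - 4 * (ρ y / s)))|
          ≤ ENNReal.ofReal (4 / s * (g.edist hg x y).toReal) := ENNReal.ofReal_le_ofReal hb
        _ = ENNReal.ofReal (4 / s) * g.edist hg x y := by
            rw [ENNReal.ofReal_mul (by positivity), ENNReal.ofReal_toReal hxy]

end RawCutoff

/-! ### Smooth cutoffs adapted to geodesic balls, with a universal gradient bound -/

/-- **Cutoffs adapted to geodesic balls (hypothesis (HC) of `perelman_noLocalCollapsing_of_cutoffs`).**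
There is a universal constant `C₀` such that for every smooth Riemannian metric `g` on a closed
manifold (compact, Hausdorff, second countable, boundaryless finite-dimensional model), every
`p ∈ M` and `s > 0` there is a `C^∞` function `χ : M → [0, 1]` with `χ = 1` on the geodesic ball
`B(p, s/2)`, `tsupport χ ⊆ B(p, s)` and `|∇χ|²_g ≤ C₀/s²` everywhere — the smooth version of
Topping's test cutoff `ψ(d(x,p)/r)` (2006, proof of Lemma 8.3.5, "`|∇φ| ≤ (1/r) sup|ψ'|`"):
smooth the `4/s`-Lipschitz raw cutoff `F` (`exists_raw_cutoff`) to within `1/8` with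
`|∇χ̃| ≤ 4/s + 1/s` (`exists_contMDiff_abs_sub_lt_gradSq_le`) and clamp, `χ = Λ ∘ χ̃`
(`exists_smooth_clamp`), so that `C₀ = 25 sup|Λ'|²`. [cite: Topping2006, §8.3, proof of Lemma 8.3.5] -/
theorem exists_metric_cutoff : ∃ C₀ : ℝ,
    ∀ {E : Type u} [NormedAddCommGroup E] [NormedSpace ℝ E] [FiniteDimensional ℝ E]
      {H : Type v} [TopologicalSpace H] (I : ModelWithCorners ℝ E H) [I.Boundaryless]
      (M : Type w) [TopologicalSpace M] [T2Space M] [SecondCountableTopology M] [CompactSpace M]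
      [ChartedSpace H M] [IsManifold I ∞ M]
      (g : PseudoRiemannianMetric I ∞ E (TangentSpace I : M → Type _)),
      g.IsRiemannian → ∀ (p : M) (s : ℝ), 0 < s → ∃ χ : M → ℝ,
        ContMDiff I 𝓘(ℝ, ℝ) ∞ χ ∧ (∀ x, 0 ≤ χ x) ∧ (∀ x, χ x ≤ 1) ∧
        (∀ x ∈ g.ball p (ENNReal.ofReal (s / 2)), χ x = 1) ∧
        tsupport χ ⊆ g.ball p (ENNReal.ofReal s) ∧ ∀ x, g.gradSq χ x ≤ C₀ / s ^ 2 := by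
  obtain ⟨Λ, C, hC0, hΛs, hΛ0, hΛ1, hΛzero, hΛone, hΛd⟩ := exists_smooth_clamp
  refine ⟨25 * C ^ 2, ?_⟩
  intro E _ _ _ H _ I _ M _ _ _ _ _ _ g hg p s hs
  -- the raw cutoff and its smoothing
  obtain ⟨F, hFc, hF0, hF1, hFone, hFpos, hFlip⟩ := exists_raw_cutoff hg p hs
  set ε : ℝ := min (1 / 8) (1 / s) with hε
  have hεpos : 0 < ε := by positivity
  have hε8 : ε ≤ 1 / 8 := min_le_left _ _
  have hεs : ε ≤ 1 / s := min_le_right _ _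
  obtain ⟨χt, hχts, hχtF, hχtgrad⟩ := exists_contMDiff_abs_sub_lt_gradSq_le g hg hFc
    (by positivity : (0 : ℝ) ≤ 4 / s) hFlip hεpos
  -- the clamped cutoff
  refine ⟨fun x ↦ Λ (χt x), hΛs.comp_contMDiff hχts, fun x ↦ hΛ0 _, fun x ↦ hΛ1 _,
    fun x hx ↦ ?_, ?_, fun x ↦ ?_⟩
  · -- `= 1` on `B(p, s/2)`: there `F = 1`, so `χt > 7/8 ≥ 3/4`
    have hd : g.edist hg p x < ENNReal.ofReal (s / 2) := by
      simpa [PseudoRiemannianMetric.mem_ball, PseudoRiemannianMetric.riemEDist_eq hg] using hx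
    have h1 := hFone x hd
    have h2 := hχtF x
    rw [h1] at h2
    exact hΛone _ (by linarith [(abs_lt.1 h2).1])
  · -- support: `Λ (χt x) ≠ 0 ⇒ χt x > 1/4 ⇒ F x > 0 ⇒ d(p, x) < 3s/4 < s`
    intro x hx
    have hcl : tsupport (fun x ↦ Λ (χt x)) ⊆ {x | 1 / 4 ≤ χt x} := by
      refine closure_minimal (fun y hy ↦ ?_) (isClosed_le continuous_const hχts.continuous)
      by_contra hlt
      simp only [mem_setOf_eq, not_le] at hlt
      exact hy (hΛzero _ hlt.le)
    have hχx : 1 / 4 ≤ χt x := hcl hx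
    have hFx : 0 < F x := by linarith [(abs_lt.1 (hχtF x)).2]
    have hd := hFpos x hFx
    rw [PseudoRiemannianMetric.mem_ball, PseudoRiemannianMetric.riemEDist_eq hg]
    exact hd.trans_le (ENNReal.ofReal_le_ofReal (by linarith))
  · -- gradient: `|∇(Λ ∘ χt)|² = Λ'(χt)² |∇χt|² ≤ C² (4/s + ε)² ≤ 25 C²/s²`
    have hd : HasDerivAt Λ (deriv Λ (χt x)) (χt x) :=
      ((hΛs.differentiable (by simp)) _).hasDerivAt
    have hmd : MDifferentiableAt I 𝓘(ℝ, ℝ) χt x := (hχts x).mdifferentiableAt (by simp)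
    rw [show (fun x ↦ Λ (χt x)) = Λ ∘ χt from rfl, g.gradSq_real_comp hd hmd]
    have h1 : deriv Λ (χt x) ^ 2 ≤ C ^ 2 := by
      rw [← sq_abs]
      exact pow_le_pow_left₀ (abs_nonneg _) (hΛd _) 2
    have h2 : g.gradSq χt x ≤ (5 / s) ^ 2 := by
      refine (hχtgrad x).trans (pow_le_pow_left₀ (by positivity) ?_ 2)
      calc 4 / s + ε ≤ 4 / s + 1 / s := by linarith
        _ = 5 / s := by ring
    have h3 : 0 ≤ g.gradSq χt x := g.gradSq_nonneg hg χt x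
    calc deriv Λ (χt x) ^ 2 * g.gradSq χt x ≤ C ^ 2 * (5 / s) ^ 2 :=
          mul_le_mul h1 h2 h3 (sq_nonneg _)
      _ = 25 * C ^ 2 / s ^ 2 := by ring

/-! ### (T2) ∧ (T3) ⇒ `perelman_noLocalCollapsing` -/

/-- **Perelman's no local collapsing theorem I from the monotonicity of `μ` and its lower
bound.** With the cutoffs of `exists_metric_cutoff`, the conditional theorem
`perelman_noLocalCollapsing_of_cutoffs` (`PerelmanEntropyCutoff.lean`: Topping's Lemma 8.3.5,
Thm. 8.3.4, Thm. 8.3.1, the halving iteration and the parabolic `κ`-form) leaves exactly two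
analytic hypotheses:
* `h₂` (**Topping 2006, (8.3.10)**, from the entropy formula, Prop. 8.2.1, and the backward
  solvability of the conjugate heat equation, Rem. 8.2.5; Perelman 2002, (3.4)): for a Ricci flow
  of Riemannian metrics on a closed manifold on `[0, T']`, `T' > 0`, and `τ > 0`,
  `μ(g(0), τ + T') ≤ μ(g(T'), τ)`;
* `h₃` (**Topping 2006, Lemma 8.1.8**, second part; Perelman 2002, §3.1): for a Riemannian
  metric with Levi-Civita connection on a closed manifold and `τ₀ > 0`, `μ(g, τ)` is bounded below
  for `τ ∈ (0, τ₀]`.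
This is NOT a discharge of the named fact `perelman_noLocalCollapsing`; it is the fact made
conditional on precisely the `𝒲`-entropy monotonicity and the Sobolev-type lower bound.
[cite: Topping2006, §8.3, Thm. 8.3.1] [cite: Perelman2002, §4, Thm. 4.1] -/
theorem perelman_noLocalCollapsing_of_muMonotone_of_muLowerBound
    (h₂ : ∀ {E : Type u} [NormedAddCommGroup E] [NormedSpace ℝ E] [FiniteDimensional ℝ E]
      {H : Type v} [TopologicalSpace H] (I : ModelWithCorners ℝ E H) [I.Boundaryless]
      (M : Type w) [TopologicalSpace M] [T2Space M] [SecondCountableTopology M] [CompactSpace M]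
      [ChartedSpace H M] [IsManifold I ∞ M] [MeasurableSpace M] [BorelSpace M] (T' : ℝ), 0 < T' →
      ∀ (g : ℝ → PseudoRiemannianMetric I ∞ E (TangentSpace I : M → Type _))
        (cov : ℝ → CovariantDerivative I E (TangentSpace I : M → Type _)),
        IsRicciFlow g cov (Icc 0 T') → (∀ t ∈ Icc 0 T', (g t).IsRiemannian) →
          ∀ τ : ℝ, 0 < τ → (g 0).muEntropy (cov 0) (τ + T') ≤ (g T').muEntropy (cov T') τ)
    (h₃ : ∀ {E : Type u} [NormedAddCommGroup E] [NormedSpace ℝ E] [FiniteDimensional ℝ E]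
      {H : Type v} [TopologicalSpace H] (I : ModelWithCorners ℝ E H) [I.Boundaryless]
      (M : Type w) [TopologicalSpace M] [T2Space M] [SecondCountableTopology M] [CompactSpace M]
      [ChartedSpace H M] [IsManifold I ∞ M] [MeasurableSpace M] [BorelSpace M]
      (g : PseudoRiemannianMetric I ∞ E (TangentSpace I : M → Type _))
      (cov : CovariantDerivative I E (TangentSpace I : M → Type _)),
      g.IsRiemannian → g.IsLeviCivita cov → ∀ τ₀ : ℝ, 0 < τ₀ →
        ∃ m : ℝ, ∀ τ ∈ Ioc 0 τ₀, (m : EReal) ≤ g.muEntropy cov τ) :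
    perelman_noLocalCollapsing.{u, v, w} := by
  obtain ⟨C₀, hC₀⟩ := exists_metric_cutoff.{u, v, w}
  exact perelman_noLocalCollapsing_of_cutoffs C₀
    (fun I _ M _ _ _ _ _ _ g hg p s hs ↦ hC₀ I M g hg p s hs) h₂ h₃

end Literature.Geometry.Riemannian

end
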